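import Literature.Computability.Cryptography.TreeSigExperiment
import Literature.Computability.Cryptography.OracleSimIndexedFst
import Literature.Computability.Complexity.TruthTableTransducers
import Literature.Computability.Complexity.OraclePrefixPost
import Literature.Computability.Complexity.ListFoldBricks
import HarnessLib

/-!
# The authentication-tree scheme, IV: the emulated attack and the PRF distinguisher (the machines)

Topic `Literature/Computability/Cryptography`; continues `TreeSigExperiment.lean`. Goldreich's proof of
Prop. 6.4.17 (security of the memoryless Construction 6.4.16) turns a chosen-message forger `𝒜` of the tree scheme
into a distinguisher `D` of the function ensemble: `D`, given oracle access to `φ` (either `F_k` or a truly random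
function), emulates the whole attack — key generation, the forger, the signing oracle — with the node blocks
obtained from `φ`, and accepts iff the forger forges. Here `D` is built as a NON-ADAPTIVE oracle machine: since the
leaves `σ₁, …, σ_T` of the `T = TA(n)` potential signatures are `D`'s own coins, the blocks the attack can ever need
are those of the root and of the `2n` children along each of the `T` paths, and `D` fetches them all up front
(`ttFnAlgL`, `TruthTableTransducers.lean`), then runs the attack as a plain polynomial-time computation on the
fetched table (`OracleAlg.simFn` of the emulated forger `OracleAlg.simM`, `OracleSimIndexed.lean`). Contents:

* `labAt n ρ j` — the label fetched in round `j` (`0`: the root; `j = 1 + 2n·i + t`: the `t`-th children label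
  along the `i`-th leaf `blk n i ρ`), `pos n i L` — the round in which the label `L` of path `i` is fetched
  (`labAt_pos`); the query map `QD` (`FP`, `QD_apply`);
* `blkTF` — the block source reading the fetched table at `pos` (`FP`, `blkTF_apply`), hence the node functions
  `pkF₀ P blkTF`, `sgF₀ P blkTF` of `TreeSigPrograms.lean` over the table;
* `preD`, `ansD`, `hOut`, `EM` — the forger's input, the answering rule (the `i`-th query `α` is answered by the
  record `⟨α, sigG (table of path i) α (blk n i ρ)⟩`, `ansD_apply`), the output rule and the emulated forger;
* `resD`, `GD` — the result of the emulation and the forgery test on it (`FP`); **`distinguisher P 𝒜`** — the PRF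
  adversary `D` (`isPPT_distinguisher`).

The semantics of `D` (its acceptance is exactly the forgery event `ForgeWith` of the node-interface attack whose
blocks are `φ ∘ code n`) and the probability accounting are in `TreeSigDistinguisherRun.lean`.

All statements proved; no named facts.

## References

* O. Goldreich, *Foundations of Cryptography II: Basic Applications*, CUP 2004, §6.4.2.3, proof of Prop. 6.4.17
  ("any efficient forger against Construction 6.4.16 yields a distinguisher of the pseudorandom function").
* O. Goldreich, S. Goldwasser, S. Micali, *How to construct random functions*, J. ACM 33 (1986), §3.
-/

namespace Literature.Computability.Cryptography

open _root_.Computability Complexity Complexity.Brick Polynomial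
open Complexity.Plumb Complexity.OracleCompose Complexity.HashBricks Complexity.OracleAlg

namespace TreeSig

variable (P : Spec) (𝒜 : OracleAdversary (List Bool × List Bool))

/-! ### Budgets as polynomials -/

/-- The forger's input length as a polynomial: `4X + 2 PK + 6`. [folklore] -/
noncomputable def ℓxPoly : Polynomial ℕ := 4 * X + 2 * P.PK + 6

/-- `ℓx n = ℓxPoly(n)`. [folklore] -/
theorem ℓx_eq (n : ℕ) : ℓx P n = (ℓxPoly P).eval n := by simp [ℓx, ℓxPoly]

/-- The forger's coin budget as a polynomial. [folklore] -/
noncomputable def cAPoly : Polynomial ℕ := 𝒜.coins.comp (ℓxPoly P)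

/-- `cA n = cAPoly(n)`. [folklore] -/
theorem cA_eq (n : ℕ) : cA P 𝒜 n = (cAPoly P 𝒜).eval n := by rw [cA, cAPoly, eval_comp, ℓx_eq]

/-- The forger's round budget as a polynomial. [folklore] -/
noncomputable def TAPoly : Polynomial ℕ := 𝒜.fuel.comp (ℓxPoly P)

/-- `TA n = TAPoly(n)`. [folklore] -/
theorem TA_eq (n : ℕ) : TA P 𝒜 n = (TAPoly P 𝒜).eval n := by rw [TA, TAPoly, eval_comp, ℓx_eq]

/-- The number of fetched blocks: `1 + 2n · TA(n)`. [folklore] -/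
noncomputable def qD : Polynomial ℕ := 1 + 2 * X * TAPoly P 𝒜

/-- `qD(n) = 1 + 2n·TA(n)`. [folklore] -/
theorem qD_eval (n : ℕ) : (qD P 𝒜).eval n = 1 + 2 * n * TA P 𝒜 n := by simp [qD, TA_eq]

/-- The distinguisher's coins: the forger's coins, then `TA(n)` leaves of `n` bits. [folklore] -/
noncomputable def cDPoly : Polynomial ℕ := cAPoly P 𝒜 + TAPoly P 𝒜 * X

/-- `cDPoly(n) = cA(n) + TA(n)·n`. [folklore] -/
theorem cDPoly_eval (n : ℕ) : (cDPoly P 𝒜).eval n = cA P 𝒜 n + TA P 𝒜 n * n := by simp [cDPoly, cA_eq, TA_eq]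

/-- The forger's coins inside the distinguisher's: the first `cA(n)` bits. [folklore] -/
def rA (n : ℕ) (r : List Bool) : List Bool := r.take (cA P 𝒜 n)

/-- The leaves inside the distinguisher's coins: the bits after the first `cA(n)`. [folklore] -/
def ρD (n : ℕ) (r : List Bool) : List Bool := r.drop (cA P 𝒜 n)

/-! ### Labels by fetch round -/

/-- Entries of `pathLabelsFrom`: the `t`-th label is `pre σ₁⋯σ_{t/2} [t odd]`. [folklore] -/
theorem getElem_pathLabelsFrom : ∀ (pre σ : List Bool) (t : ℕ) (ht : t < (pathLabelsFrom pre σ).length),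
    (pathLabelsFrom pre σ)[t] = pre ++ σ.take (t / 2) ++ [decide (t % 2 = 1)]
  | _, [], t, ht => by simp [pathLabelsFrom] at ht
  | pre, b :: σ, 0, _ => by simp [pathLabelsFrom]
  | pre, b :: σ, 1, _ => by simp [pathLabelsFrom]
  | pre, b :: σ, t + 2, ht => by
    have ht' : t < (pathLabelsFrom (pre ++ [b]) σ).length := by
      simp only [pathLabelsFrom, List.length_cons] at ht; omega
    simp only [pathLabelsFrom, List.getElem_cons_succ]
    rw [getElem_pathLabelsFrom (pre ++ [b]) σ t ht']
    have h2 : (t + 2) / 2 = t / 2 + 1 := by omega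
    rw [h2, List.take_succ_cons, Nat.add_mod_right]
    simp

/-- Entries of `pathLabels`. [folklore] -/
theorem getElem_pathLabels (σ : List Bool) (t : ℕ) (ht : t < (pathLabels σ).length) :
    (pathLabels σ)[t] = σ.take (t / 2) ++ [decide (t % 2 = 1)] := by
  simp only [pathLabels] at ht ⊢
  simpa using getElem_pathLabelsFrom [] σ t ht

/-- The label fetched in round `j`: the root in round `0`; in round `1 + 2n·i + t` (`t < 2n`) the `t`-th children
label along the `i`-th leaf `blk n i ρ`. [Goldreich 2004, proof of Prop. 6.4.17 (the blocks the attack uses)] [folklore] -/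
def labAt (n : ℕ) (ρ : List Bool) (j : ℕ) : List Bool :=
  if j = 0 then [] else (Yao.blk n ((j - 1) / (2 * n)) ρ).take ((j - 1) % (2 * n) / 2) ++ [decide ((j - 1) % (2 * n) % 2 = 1)]

/-- Round `0` fetches the root. [folklore] -/
@[simp] theorem labAt_zero (n : ℕ) (ρ : List Bool) : labAt n ρ 0 = [] := by simp [labAt]

/-- `|labAt n ρ j| ≤ n`. [folklore] -/
theorem length_labAt_le (n : ℕ) (ρ : List Bool) (j : ℕ) (hn : 0 < n) : (labAt n ρ j).length ≤ n := by
  unfold labAt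
  split_ifs
  · simp
  · have h1 : (j - 1) % (2 * n) / 2 < n := by
      have := Nat.mod_lt (j - 1) (show 0 < 2 * n by omega); omega
    have h2 := Yao.length_blk_le n ((j - 1) / (2 * n)) ρ
    simp only [List.length_append, List.length_take, List.length_singleton]; omega

/-- The fetch round of the label `L` met on path `i`: `0` for the root, else `1 + 2n·i + 2(|L| - 1) + [last bit]`.
[folklore] -/
def pos (n i : ℕ) (L : List Bool) : ℕ := if L = [] then 0 else 1 + i * (2 * n) + (2 * (L.length - 1) + if L.getLast? = some true then 1 else 0)

/-- The round of the `t`-th path label of leaf `i` is `1 + 2n·i + t`. [folklore] -/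
theorem pos_getElem_pathLabels (n i : ℕ) (σ : List Bool) (t : ℕ) (ht : t < (pathLabels σ).length) :
    pos n i ((pathLabels σ)[t]) = 1 + i * (2 * n) + t := by
  rw [getElem_pathLabels σ t ht, pos, if_neg (by simp)]
  have hlen : (σ.take (t / 2) ++ [decide (t % 2 = 1)]).length = t / 2 + 1 := by
    rw [length_pathLabels] at ht
    simp only [List.length_append, List.length_take, List.length_singleton]; omega
  rw [hlen, List.getLast?_append, List.getLast?_singleton, Option.some_or]
  rcases Nat.mod_two_eq_zero_or_one t with h | h
  · rw [if_neg (by simp [h])]; omega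
  · rw [if_pos (by simp [h])]; omega

/-- **The label fetched in the round of a path label is that label** (leaves of full length). [folklore] -/
theorem labAt_pos (n i : ℕ) (ρ : List Bool) (hρ : (i + 1) * n ≤ ρ.length) (t : ℕ) (ht : t < 2 * n) :
    labAt n ρ (1 + i * (2 * n) + t) = (pathLabels (Yao.blk n i ρ))[t]'(by rw [length_pathLabels, Yao.length_blk_of_le hρ]; exact ht) := by
  have hn : 0 < 2 * n := by omega
  rw [getElem_pathLabels, labAt, if_neg (by omega)]
  have h1 : (1 + i * (2 * n) + t - 1) = t + i * (2 * n) := by omega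
  rw [h1, Nat.add_mul_div_right _ _ hn, Nat.div_eq_of_lt ht, Nat.zero_add, Nat.add_mul_mod_self_right, Nat.mod_eq_of_lt ht]

/-! ### The query map of the distinguisher -/

section Query

/-- `1ⁿ` read off the query record `⟨⟨1ⁿ, r⟩, 1ʲ⟩` (normalised). [folklore] -/
noncomputable def qnF : List Bool → List Bool := onesFn ∘ fstF ∘ fstF
/-- The leaves `ρ = r ⇂ cA(n)`. [folklore] -/
noncomputable def qρF : List Bool → List Bool := dropFn ∘ fanoutFn (polyFn (cAPoly P 𝒜) ∘ qnF) (sndF ∘ fstF)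
/-- `1^{j-1}`. [folklore] -/
noncomputable def qjF : List Bool → List Bool := dropFn ∘ fanoutFn (fun _ => [true]) sndF
/-- `⟨1^{(j-1)/(2n)}, 1^{(j-1) mod 2n}⟩`. [folklore] -/
noncomputable def qdmF : List Bool → List Bool := divModFn ∘ fanoutFn (appF ∘ fanoutFn qnF qnF) (qjF)
/-- `⟨1^{t/2}, 1^{t mod 2}⟩` for `t = (j-1) mod 2n`. [folklore] -/
noncomputable def qhF : List Bool → List Bool := divModFn ∘ fanoutFn (fun _ => ones 2) (sndF ∘ qdmF)
/-- The leaf `blk n i ρ = (ρ ⇂ i·n) ↾ n`. [folklore] -/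
noncomputable def qσF : List Bool → List Bool :=
  takeFn ∘ fanoutFn qnF (dropFn ∘ fanoutFn (umulFn ∘ fanoutFn (fstF ∘ qdmF) qnF) (qρF P 𝒜))
/-- The bit `[t odd]`. [folklore] -/
noncomputable def qbitF : List Bool → List Bool := iteFn (isNilFn ∘ sndF ∘ qhF) (fun _ => [false]) fun _ => [true]
/-- The label `labAt n ρ j`. [folklore] -/
noncomputable def qlabF : List Bool → List Bool :=
  iteFn (isNilFn ∘ sndF) (fun _ => []) (appF ∘ fanoutFn (takeFn ∘ fanoutFn (fstF ∘ qhF) (qσF P 𝒜)) qbitF)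

/-- **The query map of `D`**: `⟨⟨1ⁿ, r⟩, 1ʲ⟩ ↦ code n (labAt n ρ j)`. [Goldreich 2004, proof of Prop. 6.4.17] [folklore] -/
noncomputable def QD : List Bool → List Bool := pad10Fn ∘ fanoutFn qnF (qlabF P 𝒜)

variable {P 𝒜}

/-- `qnF` on a query record. [folklore] -/
theorem qnF_apply (n : ℕ) (r u : List Bool) : qnF (boolPair (boolPair (unaryEncodeNat n) r) u) = ones n := by
  simp [qnF, onesFn, Complexity.unaryEncodeNat_eq_replicate]

/-- `qlabF` computes `labAt`. [folklore] -/
theorem qlabF_apply (n : ℕ) (r : List Bool) (j : ℕ) :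
    qlabF P 𝒜 (boolPair (boolPair (unaryEncodeNat n) r) (List.replicate j true)) = labAt n (ρD P 𝒜 n r) j := by
  have hn : qnF (boolPair (boolPair (unaryEncodeNat n) r) (List.replicate j true)) = ones n := qnF_apply n r _
  have hρ : qρF P 𝒜 (boolPair (boolPair (unaryEncodeNat n) r) (List.replicate j true)) = ρD P 𝒜 n r := by
    rw [qρF, Function.comp_apply, fanoutFn_apply, Function.comp_apply, hn, polyFn_apply, List.length_replicate, Function.comp_apply,
      fstF_boolPair, sndF_boolPair, dropFn_boolPair, List.length_replicate, ρD, cA_eq]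
  have hj : qjF (boolPair (boolPair (unaryEncodeNat n) r) (List.replicate j true)) = ones (j - 1) := by
    rw [qjF, Function.comp_apply, fanoutFn_apply, sndF_boolPair, dropFn_boolPair, List.length_singleton, List.drop_replicate]
  have hdm : qdmF (boolPair (boolPair (unaryEncodeNat n) r) (List.replicate j true)) = boolPair (ones ((j - 1) / (2 * n))) (ones ((j - 1) % (2 * n))) := by
    rw [qdmF, Function.comp_apply, fanoutFn_apply, Function.comp_apply, fanoutFn_apply, appF_boolPair, hn, hj,
      show ones n ++ ones n = ones (2 * n) by rw [two_mul]; exact (List.replicate_add n n true).symm, divModFn_boolPair]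
  have hh : qhF (boolPair (boolPair (unaryEncodeNat n) r) (List.replicate j true)) =
      boolPair (ones ((j - 1) % (2 * n) / 2)) (ones ((j - 1) % (2 * n) % 2)) := by
    rw [qhF, Function.comp_apply, fanoutFn_apply, Function.comp_apply, hdm, sndF_boolPair, divModFn_boolPair]
  have hσ : qσF P 𝒜 (boolPair (boolPair (unaryEncodeNat n) r) (List.replicate j true)) = Yao.blk n ((j - 1) / (2 * n)) (ρD P 𝒜 n r) := by
    rw [qσF, Function.comp_apply, fanoutFn_apply, hn, Function.comp_apply, fanoutFn_apply, Function.comp_apply, fanoutFn_apply,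
      Function.comp_apply, hdm, fstF_boolPair, hn, umulFn_boolPair, hρ, dropFn_boolPair, takeFn_boolPair, List.length_replicate,
      List.length_replicate, Yao.blk]
  have hbit : qbitF (boolPair (boolPair (unaryEncodeNat n) r) (List.replicate j true)) = [decide ((j - 1) % (2 * n) % 2 = 1)] := by
    have hc : (isNilFn ∘ sndF ∘ qhF) (boolPair (boolPair (unaryEncodeNat n) r) (List.replicate j true)) = [decide ((j - 1) % (2 * n) % 2 = 0)] := by
      rw [Function.comp_apply, Function.comp_apply, hh, sndF_boolPair]
      simp [isNilFn, ones, List.replicate_eq_nil_iff]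
    rw [qbitF, iteFn_apply hc]
    rcases Nat.mod_two_eq_zero_or_one ((j - 1) % (2 * n)) with h | h <;> simp [h]
  have hnil : (isNilFn ∘ sndF) (boolPair (boolPair (unaryEncodeNat n) r) (List.replicate j true)) = [decide (j = 0)] := by
    rw [Function.comp_apply, sndF_boolPair]
    simp [isNilFn, List.replicate_eq_nil_iff]
  rw [qlabF, iteFn_apply hnil, labAt]
  by_cases hj0 : j = 0
  · simp [hj0]
  · rw [decide_eq_false hj0, if_neg hj0]
    simp only [Bool.false_eq_true, if_false, Function.comp_apply, fanoutFn_apply, appF_boolPair, hh, fstF_boolPair, hσ, takeFn_boolPair, hbit,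
      List.length_replicate]

variable (P 𝒜)

/-- **`QD` computes the label codes.** [folklore] -/
theorem QD_apply (n : ℕ) (r : List Bool) (j : ℕ) :
    QD P 𝒜 (boolPair (boolPair (unaryEncodeNat n) r) (List.replicate j true)) = code n (labAt n (ρD P 𝒜 n r) j) := by
  rw [QD, Function.comp_apply, fanoutFn_apply, qlabF_apply, qnF, Function.comp_apply, Function.comp_apply, fstF_boolPair, fstF_boolPair,
    pad10Fn_onesFn, Complexity.unaryEncodeNat_eq_replicate, List.length_replicate]

/-- `qlabF ∈ FP`. [folklore] -/
theorem qlabF_mem_FP : qlabF P 𝒜 ∈ FP := by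
  have hn : qnF ∈ FP := comp_mem_FP onesFn_mem_FP (comp_mem_FP fstF_mem_FP fstF_mem_FP)
  have hρ : qρF P 𝒜 ∈ FP := comp_mem_FP dropFn_mem_FP (fanoutFn_mem_FP (comp_mem_FP (polyFn_mem_FP _) hn) (comp_mem_FP sndF_mem_FP fstF_mem_FP))
  have hj : qjF ∈ FP := comp_mem_FP dropFn_mem_FP (fanoutFn_mem_FP (const_mem_FP _) sndF_mem_FP)
  have hdm : qdmF ∈ FP := comp_mem_FP divModFn_mem_FP (fanoutFn_mem_FP (comp_mem_FP appF_mem_FP (fanoutFn_mem_FP hn hn)) hj)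
  have hh : qhF ∈ FP := comp_mem_FP divModFn_mem_FP (fanoutFn_mem_FP (const_mem_FP _) (comp_mem_FP sndF_mem_FP hdm))
  have hσ : qσF P 𝒜 ∈ FP := comp_mem_FP takeFn_mem_FP (fanoutFn_mem_FP hn (comp_mem_FP dropFn_mem_FP
    (fanoutFn_mem_FP (comp_mem_FP umulFn_mem_FP (fanoutFn_mem_FP (comp_mem_FP fstF_mem_FP hdm) hn)) hρ)))
  have hbit : qbitF ∈ FP := iteFn_mem_FP (comp_mem_FP isNilFn_mem_FP (comp_mem_FP sndF_mem_FP hh)) (const_mem_FP _) (const_mem_FP _)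
  have hlab : qlabF P 𝒜 ∈ FP := iteFn_mem_FP (comp_mem_FP isNilFn_mem_FP sndF_mem_FP) (const_mem_FP _)
    (comp_mem_FP appF_mem_FP (fanoutFn_mem_FP (comp_mem_FP takeFn_mem_FP (fanoutFn_mem_FP (comp_mem_FP fstF_mem_FP hh) hσ)) hbit))
  exact hlab

/-- `QD ∈ FP`. [folklore] -/
theorem QD_mem_FP : QD P 𝒜 ∈ FP := by
  have hn : qnF ∈ FP := comp_mem_FP onesFn_mem_FP (comp_mem_FP fstF_mem_FP fstF_mem_FP)
  exact comp_mem_FP pad10Fn_mem_FP (fanoutFn_mem_FP hn (qlabF_mem_FP P 𝒜))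

end Query

/-! ### The block source reading the fetched table -/

section Table

/-! The node parameters of path `i` are `s = ⟨1ⁿ, ⟨1ⁱ, tab⟩⟩` with `tab = encList blocks` the fetched table; the block of
the label `L` is `blocks[pos n i L]`. -/

/-- `1ⁿ` read off `⟨s, L⟩` (normalised). [folklore] -/
noncomputable def tnF : List Bool → List Bool := onesFn ∘ fstF ∘ fstF
/-- `1ⁱ`. [folklore] -/
noncomputable def tiF : List Bool → List Bool := onesFn ∘ fstF ∘ sndF ∘ fstF
/-- The table `tab`. [folklore] -/
noncomputable def ttabF : List Bool → List Bool := sndF ∘ sndF ∘ fstF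
/-- `1^{|L| - 1}`. [folklore] -/
noncomputable def tLm1F : List Bool → List Bool := onesFn ∘ dropFn ∘ fanoutFn (fun _ => [true]) sndF
/-- `[last bit of L = 1]` as `1` or `ε` (unary summand). [folklore] -/
noncomputable def tlastF : List Bool → List Bool := iteFn (bitAtFn ∘ fanoutFn tLm1F sndF) (fun _ => [true]) fun _ => []
/-- `1^{pos n i L}`. [folklore] -/
noncomputable def tposF : List Bool → List Bool :=
  iteFn (isNilFn ∘ sndF) (fun _ => [])
    (List.cons true ∘ appF ∘ fanoutFn (umulFn ∘ fanoutFn tiF (appF ∘ fanoutFn tnF tnF)) (appF ∘ fanoutFn (appF ∘ fanoutFn tLm1F tLm1F) tlastF))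

/-- **The table block source**: `⟨⟨1ⁿ, ⟨1ⁱ, tab⟩⟩, L⟩ ↦ item `pos n i L` of `tab`. [Goldreich 2004, proof of Prop. 6.4.17
(the emulation reads the node blocks off the answers of the oracle)] [folklore] -/
noncomputable def blkTF : List Bool → List Bool := nthItemFn ∘ fanoutFn tposF ttabF

/-- The node parameters of path `i` over the table `blocks`. [folklore] -/
def sTab (n i : ℕ) (blocks : List (List Bool)) : List Bool := boolPair (ones n) (boolPair (ones i) (encList blocks))

/-- `fstF (sTab n i blocks) = 1ⁿ`. [folklore] -/
@[simp] theorem fstF_sTab (n i : ℕ) (blocks : List (List Bool)) : fstF (sTab n i blocks) = ones n := fstF_boolPair _ _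

/-- `tposF` computes `pos`. [folklore] -/
theorem tposF_apply (n i : ℕ) (blocks : List (List Bool)) (L : List Bool) : tposF (boolPair (sTab n i blocks) L) = ones (pos n i L) := by
  have hnil : (isNilFn ∘ sndF) (boolPair (sTab n i blocks) L) = [decide (L = [])] := by
    rw [Function.comp_apply, sndF_boolPair]; rfl
  rw [tposF, iteFn_apply hnil, pos]
  by_cases hL : L = []
  · rw [if_pos hL, decide_eq_true hL, if_pos rfl]; rfl
  · rw [if_neg hL, decide_eq_false hL, if_neg Bool.false_ne_true]
    have hn : tnF (boolPair (sTab n i blocks) L) = ones n := by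
      simp only [tnF, sTab, Function.comp_apply, fstF_boolPair, onesFn, Complexity.unaryEncodeNat_eq_replicate, List.length_replicate]
    have hi : tiF (boolPair (sTab n i blocks) L) = ones i := by
      simp only [tiF, sTab, Function.comp_apply, fstF_boolPair, sndF_boolPair, onesFn, Complexity.unaryEncodeNat_eq_replicate, List.length_replicate]
    have hm : tLm1F (boolPair (sTab n i blocks) L) = ones (L.length - 1) := by
      simp only [tLm1F, Function.comp_apply, fanoutFn_apply, sndF_boolPair, dropFn_boolPair, List.length_singleton, onesFn,
        Complexity.unaryEncodeNat_eq_replicate, List.length_drop]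
    have hlt : L.length - 1 < L.length := Nat.sub_lt (List.length_pos_of_ne_nil hL) Nat.one_pos
    have hgl : L.getLast? = some L[L.length - 1] := by rw [List.getLast?_eq_getElem?, List.getElem?_eq_getElem hlt]
    have hlast : tlastF (boolPair (sTab n i blocks) L) = if L.getLast? = some true then [true] else [] := by
      have hc : (bitAtFn ∘ fanoutFn tLm1F sndF) (boolPair (sTab n i blocks) L) = [L[L.length - 1]] := by
        rw [Function.comp_apply, fanoutFn_apply, hm, sndF_boolPair, bitAtFn_boolPair_of_lt _ _ (by rw [List.length_replicate]; exact hlt)]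
        simp only [List.length_replicate]
      rw [tlastF, iteFn_apply hc, hgl]
      cases L[L.length - 1] <;> rfl
    have hval : (List.cons true ∘ appF ∘ fanoutFn (umulFn ∘ fanoutFn tiF (appF ∘ fanoutFn tnF tnF))
        (appF ∘ fanoutFn (appF ∘ fanoutFn tLm1F tLm1F) tlastF)) (boolPair (sTab n i blocks) L) =
        true :: (ones (i * (ones n ++ ones n).length) ++ (ones (L.length - 1) ++ ones (L.length - 1) ++ (if L.getLast? = some true then [true] else []))) := by
      simp only [Function.comp_apply, fanoutFn_apply, appF_boolPair]
      rw [hi, hn, hm, hlast, umulFn_apply, fstF_boolPair, sndF_boolPair, List.length_replicate]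
    have h2 : (ones n ++ ones n).length = 2 * n := by simp only [List.length_append, List.length_replicate]; omega
    have hones : ∀ a c : ℕ, ones a ++ ones c = ones (a + c) := fun a c => (List.replicate_add a c true).symm
    have hcons : ∀ k : ℕ, true :: ones k = ones (k + 1) := fun k => rfl
    rw [hval, h2]
    by_cases hb : L.getLast? = some true
    · rw [if_pos hb, if_pos hb, show ([true] : List Bool) = ones 1 from rfl, hones, hones, hones, hcons]
      exact congrArg ones (by omega)
    · rw [if_neg hb, if_neg hb, List.append_nil, hones, hones, hcons]
      exact congrArg ones (by omega)

/-- `nthItemFn ⟨1ᵖ, encList l⟩ = l[p]` (junk `ε` past the end). [folklore] -/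
theorem nthItemFn_encList (p : ℕ) (l : List (List Bool)) : nthItemFn (boolPair (ones p) (encList l)) = l.getD p [] := by
  rw [nthItemFn_boolPair, List.length_replicate, sndF_iterate_encList, fstF_encList, List.getD_eq_getElem?_getD, List.headD_eq_head?_getD,
    List.head?_drop]

/-- **`blkTF` reads the table at `pos`.** [folklore] -/
theorem blkTF_apply (n i : ℕ) (blocks : List (List Bool)) (L : List Bool) :
    blkTF (boolPair (sTab n i blocks) L) = blocks.getD (pos n i L) [] := by
  rw [blkTF, Function.comp_apply, fanoutFn_apply, tposF_apply]
  simp only [ttabF, Function.comp_apply, fstF_boolPair, sTab, sndF_boolPair, nthItemFn_encList]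

/-- `blkTF ∈ FP`. [folklore] -/
theorem blkTF_mem_FP : blkTF ∈ FP := by
  have hn : tnF ∈ FP := comp_mem_FP onesFn_mem_FP (comp_mem_FP fstF_mem_FP fstF_mem_FP)
  have hi : tiF ∈ FP := comp_mem_FP onesFn_mem_FP (comp_mem_FP fstF_mem_FP (comp_mem_FP sndF_mem_FP fstF_mem_FP))
  have htab : ttabF ∈ FP := comp_mem_FP sndF_mem_FP (comp_mem_FP sndF_mem_FP fstF_mem_FP)
  have hm : tLm1F ∈ FP := comp_mem_FP onesFn_mem_FP (comp_mem_FP dropFn_mem_FP (fanoutFn_mem_FP (const_mem_FP _) sndF_mem_FP))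
  have hlast : tlastF ∈ FP := iteFn_mem_FP (comp_mem_FP bitAtFn_mem_FP (fanoutFn_mem_FP hm sndF_mem_FP)) (const_mem_FP _) (const_mem_FP _)
  have hpos : tposF ∈ FP := iteFn_mem_FP (comp_mem_FP isNilFn_mem_FP sndF_mem_FP) (const_mem_FP _)
    (comp_mem_FP (cons_mem_FP true) (comp_mem_FP appF_mem_FP (fanoutFn_mem_FP
      (comp_mem_FP umulFn_mem_FP (fanoutFn_mem_FP hi (comp_mem_FP appF_mem_FP (fanoutFn_mem_FP hn hn))))
      (comp_mem_FP appF_mem_FP (fanoutFn_mem_FP (comp_mem_FP appF_mem_FP (fanoutFn_mem_FP hm hm)) hlast)))))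
  exact comp_mem_FP nthItemFn_mem_FP (fanoutFn_mem_FP hpos htab)

/-- The block assignment of path `i` read off the table. [folklore] -/
def tabFun (n i : ℕ) (blocks : List (List Bool)) (L : List Bool) : List Bool := blocks.getD (pos n i L) []

/-- The node key over the table. [folklore] -/
theorem pkF₀_blkTF (n i : ℕ) (blocks : List (List Bool)) (L : List Bool) :
    pkF₀ P blkTF (boolPair (sTab n i blocks) L) = pkOf P n (tabFun n i blocks L) := by
  rw [pkF₀_apply, blkTF_apply, fstF_sTab, List.length_replicate]; rfl

/-- The node signature over the table. [folklore] -/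
theorem sgF₀_blkTF (n i : ℕ) (blocks : List (List Bool)) (L m : List Bool) :
    sgF₀ P blkTF (boolPair (sTab n i blocks) (boolPair L m)) = signOf P n (tabFun n i blocks L) m := by
  rw [sgF₀_apply, blkTF_apply, fstF_sTab, List.length_replicate]; rfl

end Table

/-! ### The chain loop, pieces bounded along the path only -/

section Prefix

variable (pkF sgF : List Bool → List Bool) (Pc : Polynomial ℕ)

/-- **The loop computes the chain items** — as `loopModel_chainBody`, but the clip is only required to be inactive on
the records the loop actually meets: a nonempty bit source `σ'` and a prefix `pre` with `pre σ' = pre₀ σ` (the node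
`pre` lies on the path). [Goldreich 2004, Construction 6.4.14 (signing loop)] [folklore] -/
theorem loopModel_chainBody_prefix (x pre₀ σ₀ : List Bool)
    (hshort : ∀ (cnt σ' pre acc : List Bool), σ' ≠ [] → pre ++ σ' = pre₀ ++ σ₀ →
      (pieceZ pkF sgF (boolPair x (boolPair cnt (boolPair σ' (boolPair pre acc))))).length ≤ Pc.eval x.length) :
    ∀ (σ pre acc : List Bool), pre ++ σ = pre₀ ++ σ₀ →
    loopModel (chainBody pkF sgF Pc) x σ.length (boolPair σ (boolPair pre acc)) =
      boolPair [] (boolPair (pre ++ σ) (acc ++ encList (chainItems (fun L => pkF (boolPair (fstF x) L))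
        (fun L m => sgF (boolPair (fstF x) (boolPair L m))) pre σ)))
  | [], pre, acc, _ => by simp [loopModel, chainItems]
  | b :: σ, pre, acc, hle => by
    rw [List.length_cons, loopModel, chainBody_apply, clipP_eq_self (by rw [fstF_boolPair]; exact hshort _ _ _ _ (List.cons_ne_nil _ _) hle),
      pieceZ_apply, loopModel_chainBody_prefix x pre₀ σ₀ hshort σ (pre ++ [b]) _ (by rw [List.append_assoc, List.singleton_append]; exact hle),
      chainItems, List.append_assoc, List.append_assoc, ← encList_append]
    rfl

/-- **Semantics of `chainFn`**, clip required only along the path: as `chainFn_apply` with `hshort` restricted to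
nonempty `σ'` and `pre σ' = σ`. [Goldreich 2004, Construction 6.4.14] [folklore] -/
theorem chainFn_apply_prefix (prm α σ : List Bool) (hσ : σ.length ≤ (boolPair prm α).length)
    (hshort : ∀ (cnt σ' pre acc : List Bool), σ' ≠ [] → pre ++ σ' = σ →
      (pieceZ pkF sgF (boolPair (boolPair prm α) (boolPair cnt (boolPair σ' (boolPair pre acc))))).length ≤ Pc.eval (boolPair prm α).length) :
    chainFn pkF sgF Pc (boolPair (boolPair prm α) σ) =
      encList (σ :: chainG (fun L => pkF (boolPair prm L)) (fun L m => sgF (boolPair prm (boolPair L m))) α [] σ) := by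
  have hrun : chainRun pkF sgF Pc (boolPair (boolPair prm α) σ) =
      boolPair (boolPair prm α) (boolPair [] (boolPair [] (boolPair σ (encList (chainItems (fun L => pkF (boolPair prm L))
        (fun L m => sgF (boolPair prm (boolPair L m))) [] σ))))) := by
    rw [chainRun, Function.comp_apply, chainInit]
    simp only [fanoutFn_apply, fstF_boolPair, sndF_boolPair, Function.comp_apply, lenBinF_apply]
    rw [loopX_apply _ _ _ hσ, loopModel_chainBody_prefix pkF sgF Pc _ [] σ (fun cnt σ' pre acc hne h => hshort cnt σ' pre acc hne (by simpa using h))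
      σ [] [] (by simp)]
    simp
  rw [chainFn]
  simp only [fanoutFn_apply, sndF_boolPair, fstF_boolPair, Function.comp_apply, appF_boolPair, hrun]
  rw [chainG, encList_cons, encList_append, encList_singleton]
  simp [nthF, sndPow]

end Prefix

/-! ### The emulated attack -/

section Emulation

/-! The emulation input is `w = ⟨⟨1ⁿ, r⟩, ⟨1^{#blocks}, tab⟩⟩` (`D`'s input and the `listBool` code of the fetched
blocks). -/

/-- `1ⁿ` read off `w` (normalised). [folklore] -/
noncomputable def wnF : List Bool → List Bool := onesFn ∘ fstF ∘ fstF
/-- `D`'s coins `r`. [folklore] -/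
noncomputable def wrF : List Bool → List Bool := sndF ∘ fstF
/-- The table `tab`. [folklore] -/
noncomputable def wtabF : List Bool → List Bool := sndF ∘ sndF
/-- The forger's coins `r ↾ cA(n)`. [folklore] -/
noncomputable def wrAF : List Bool → List Bool := takeFn ∘ fanoutFn (polyFn (cAPoly P 𝒜) ∘ wnF) wrF
/-- The leaves `ρ = r ⇂ cA(n)`. [folklore] -/
noncomputable def wρF : List Bool → List Bool := dropFn ∘ fanoutFn (polyFn (cAPoly P 𝒜) ∘ wnF) wrF
/-- The node parameters of the root, `⟨1ⁿ, ⟨ε, tab⟩⟩`. [folklore] -/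
noncomputable def ws0F : List Bool → List Bool := fanoutFn wnF (fanoutFn (fun _ => []) wtabF)
/-- The root key `pk_ε` over the table. [folklore] -/
noncomputable def wpkF : List Bool → List Bool := pkF₀ P blkTF ∘ fanoutFn (ws0F) fun _ => []
/-- `1^{PK(n) - |pk_ε|}`. [folklore] -/
noncomputable def wpadF : List Bool → List Bool := dropFn ∘ fanoutFn (wpkF P) (polyFn P.PK ∘ wnF)
/-- The verification key `pk' = ⟨1ⁿ, ⟨pk_ε, 0^{2(PK(n)-|pk_ε|)}⟩⟩`. [folklore] -/
noncomputable def wpkTF : List Bool → List Bool :=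
  fanoutFn wnF (fanoutFn (wpkF P) (Kannan.zerosFn ∘ appF ∘ fanoutFn (wpadF P) (wpadF P)))

/-- **The forger's input** `⟨⟨1ⁿ, pk'⟩, r_A⟩`. [Goldreich 2004, proof of Prop. 6.4.17] [folklore] -/
noncomputable def preD : List Bool → List Bool := fanoutFn (fanoutFn wnF (wpkTF P)) (wrAF P 𝒜)

/-- The node parameters of path `i` from the answering record `⟨w, ⟨1ⁱ, α⟩⟩`: `⟨1ⁿ, ⟨1ⁱ, tab⟩⟩`. [folklore] -/
noncomputable def asF : List Bool → List Bool := fanoutFn (wnF ∘ fstF) (fanoutFn (onesFn ∘ fstF ∘ sndF) (wtabF ∘ fstF))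
/-- The leaf of path `i`: `blk n i ρ`. [folklore] -/
noncomputable def aσF : List Bool → List Bool :=
  takeFn ∘ fanoutFn (wnF ∘ fstF) (dropFn ∘ fanoutFn (umulFn ∘ fanoutFn (onesFn ∘ fstF ∘ sndF) (wnF ∘ fstF)) (wρF P 𝒜 ∘ fstF))

/-- **The answering rule**: the `i`-th query `α` (record `⟨w, ⟨1ⁱ, α⟩⟩`) is answered by the record
`⟨α, signature of α at the leaf blk n i ρ over the table of path i⟩` (pieces clipped at `Pc`).
[Goldreich 2004, proof of Prop. 6.4.17 (the emulated signing oracle)] [folklore] -/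
noncomputable def ansD (Pc : Polynomial ℕ) : List Bool → List Bool :=
  fanoutFn (sndF ∘ sndF) (chainFn (pkF₀ P blkTF) (sgF₀ P blkTF) Pc ∘ fanoutFn (fanoutFn asF (sndF ∘ sndF)) (aσF P 𝒜))

/-- The output rule of the emulated forger: `⟨x, ⟨lb, w⟩⟩ ↦ ⟨w, lb⟩` (output, then the coded answer records). [folklore] -/
noncomputable def hOut : List Bool → List Bool := fanoutFn (sndPow 1) (nthF 1)

/-- The output presentation of the forger's pairs. [folklore] -/
def ePair (p : List Bool × List Bool) : List Bool := boolPair p.1 p.2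

/-- **The emulated forger**: `𝒜` clocked at its own round budget read off its game input (time-out marker `[1]`),
answers read without the echoed query, queries tagged with their number, output followed by the transcript.
[Goldreich 2004, proof of Prop. 6.4.17] [folklore] -/
noncomputable def EM : OracleAlg (List Bool) := simMFst 𝒜.alg ePair 𝒜.fuel [true] sndF hOut

/-- **The result of the emulation** (rounds `R`, query cap `c`). [folklore] -/
noncomputable def resD (Pc c R : Polynomial ℕ) : List Bool → List Bool := simFn (EM 𝒜) (preD P 𝒜) (ansD P 𝒜 Pc) c R

variable {P 𝒜}

/-- `wnF` on an emulation input. [folklore] -/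
theorem wnF_apply (n : ℕ) (r lb : List Bool) : wnF (boolPair (boolPair (unaryEncodeNat n) r) lb) = ones n := by
  simp [wnF, onesFn, Complexity.unaryEncodeNat_eq_replicate]

/-- `wrAF` on an emulation input. [folklore] -/
theorem wrAF_apply (n : ℕ) (r lb : List Bool) : wrAF P 𝒜 (boolPair (boolPair (unaryEncodeNat n) r) lb) = rA P 𝒜 n r := by
  simp only [wrAF, wrF, Function.comp_apply, fanoutFn_apply, wnF_apply, polyFn_apply, List.length_replicate, fstF_boolPair, sndF_boolPair,
    takeFn_boolPair, rA, cA_eq]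

/-- `wρF` on an emulation input. [folklore] -/
theorem wρF_apply (n : ℕ) (r lb : List Bool) : wρF P 𝒜 (boolPair (boolPair (unaryEncodeNat n) r) lb) = ρD P 𝒜 n r := by
  simp only [wρF, wrF, Function.comp_apply, fanoutFn_apply, wnF_apply, polyFn_apply, List.length_replicate, fstF_boolPair, sndF_boolPair,
    dropFn_boolPair, ρD, cA_eq]

/-- `wpkF` on an emulation input: the root key over the table. [folklore] -/
theorem wpkF_apply (n : ℕ) (r : List Bool) (blocks : List (List Bool)) :
    wpkF P (boolPair (boolPair (unaryEncodeNat n) r) ((encodingList Bool).listBool.encode blocks)) = pkOf P n (blocks.getD 0 []) := by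
  have hs : fanoutFn ws0F (fun _ => []) (boolPair (boolPair (unaryEncodeNat n) r) ((encodingList Bool).listBool.encode blocks)) =
      boolPair (sTab n 0 blocks) [] := by
    rw [PrefixPostPoly.listBool_encode_eq]
    simp [ws0F, wtabF, wnF, sTab, onesFn, Complexity.unaryEncodeNat_eq_replicate, ones]
  rw [wpkF, Function.comp_apply, hs, pkF₀_blkTF]
  simp [tabFun, pos]

/-- `wpkTF` on an emulation input: the verification key. [folklore] -/
theorem wpkTF_apply (n : ℕ) (r : List Bool) (blocks : List (List Bool)) :
    wpkTF P (boolPair (boolPair (unaryEncodeNat n) r) ((encodingList Bool).listBool.encode blocks)) = pkT P n (pkOf P n (blocks.getD 0 [])) := by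
  have hpad : wpadF P (boolPair (boolPair (unaryEncodeNat n) r) ((encodingList Bool).listBool.encode blocks)) =
      ones (P.PK.eval n - (pkOf P n (blocks.getD 0 [])).length) := by
    rw [wpadF, Function.comp_apply, fanoutFn_apply, wpkF_apply, Function.comp_apply, wnF_apply, polyFn_apply, List.length_replicate, dropFn_boolPair]
    simp [ones, List.drop_replicate]
  rw [wpkTF, fanoutFn_apply, fanoutFn_apply, wnF_apply, wpkF_apply]
  simp only [Function.comp_apply, fanoutFn_apply, hpad, appF_boolPair, Kannan.zerosFn_apply, List.length_append, List.length_replicate]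
  rw [pkT, padPk, two_mul]

/-- **`preD` computes the forger's input** `⟨xA n pk_ε, r_A⟩`. [folklore] -/
theorem preD_apply (n : ℕ) (r : List Bool) (blocks : List (List Bool)) :
    preD P 𝒜 (boolPair (boolPair (unaryEncodeNat n) r) ((encodingList Bool).listBool.encode blocks)) =
      boolPair (xA P n (pkOf P n (blocks.getD 0 []))) (rA P 𝒜 n r) := by
  rw [preD, fanoutFn_apply, fanoutFn_apply, wpkTF_apply, wrAF_apply, xA, wnF_apply, Complexity.unaryEncodeNat_eq_replicate]

/-- **`ansD` computes the node-interface signature of path `i`** (clip large enough): the record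
`⟨α, sigG (tabFun n i blocks) α (blk n i ρ)⟩`. [Goldreich 2004, proof of Prop. 6.4.17] [folklore] -/
theorem ansD_apply {Pc : Polynomial ℕ} (n : ℕ) (r : List Bool) (blocks : List (List Bool)) (i : ℕ) (α : List Bool)
    (hσ : (Yao.blk n i (ρD P 𝒜 n r)).length ≤ (boolPair (sTab n i blocks) α).length)
    (hshort : ∀ (cnt σ' pre acc : List Bool), σ' ≠ [] → pre ++ σ' = Yao.blk n i (ρD P 𝒜 n r) →
      (pieceZ (pkF₀ P blkTF) (sgF₀ P blkTF) (boolPair (boolPair (sTab n i blocks) α) (boolPair cnt (boolPair σ' (boolPair pre acc))))).length ≤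
        Pc.eval (boolPair (sTab n i blocks) α).length) :
    ansD P 𝒜 Pc (boolPair (boolPair (boolPair (unaryEncodeNat n) r) ((encodingList Bool).listBool.encode blocks))
      (boolPair (unaryEncodeNat i) α)) =
      boolPair α (sigG P n (tabFun n i blocks) α (Yao.blk n i (ρD P 𝒜 n r))) := by
  set w := boolPair (boolPair (unaryEncodeNat n) r) ((encodingList Bool).listBool.encode blocks) with hw
  have hs : asF (boolPair w (boolPair (unaryEncodeNat i) α)) = sTab n i blocks := by
    rw [hw, PrefixPostPoly.listBool_encode_eq]
    simp [asF, wtabF, wnF, sTab, onesFn, Complexity.unaryEncodeNat_eq_replicate, ones]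
  have hσ' : aσF P 𝒜 (boolPair w (boolPair (unaryEncodeNat i) α)) = Yao.blk n i (ρD P 𝒜 n r) := by
    rw [aσF, hw]
    simp only [Function.comp_apply, fanoutFn_apply, fstF_boolPair, sndF_boolPair, wnF_apply, wρF_apply]
    simp only [onesFn, Complexity.unaryEncodeNat_eq_replicate, List.length_replicate, umulFn_boolPair, dropFn_boolPair, takeFn_boolPair, Yao.blk]
  rw [ansD, fanoutFn_apply]
  simp only [Function.comp_apply, fanoutFn_apply, sndF_boolPair, hs, hσ']
  rw [chainFn_apply_prefix _ _ Pc _ α _ hσ hshort, sigG, sigGI]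
  simp only [pkF₀_blkTF, sgF₀_blkTF]

variable (P 𝒜)

/-- `preD ∈ FP`. [folklore] -/
theorem preD_mem_FP (hK : P.S.keyGen.IsPolyTime unaryEncodeNat pairCode) : preD P 𝒜 ∈ FP := by
  have hn : wnF ∈ FP := comp_mem_FP onesFn_mem_FP (comp_mem_FP fstF_mem_FP fstF_mem_FP)
  have hr : wrF ∈ FP := comp_mem_FP sndF_mem_FP fstF_mem_FP
  have htab : wtabF ∈ FP := comp_mem_FP sndF_mem_FP sndF_mem_FP
  have hrA : wrAF P 𝒜 ∈ FP := comp_mem_FP takeFn_mem_FP (fanoutFn_mem_FP (comp_mem_FP (polyFn_mem_FP _) hn) hr)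
  have hs0 : ws0F ∈ FP := fanoutFn_mem_FP hn (fanoutFn_mem_FP (const_mem_FP _) htab)
  have hpk : wpkF P ∈ FP := comp_mem_FP (pkF₀_mem_FP P _ blkTF_mem_FP hK) (fanoutFn_mem_FP hs0 (const_mem_FP _))
  have hpad : wpadF P ∈ FP := comp_mem_FP dropFn_mem_FP (fanoutFn_mem_FP hpk (comp_mem_FP (polyFn_mem_FP _) hn))
  have hpkT : wpkTF P ∈ FP := fanoutFn_mem_FP hn (fanoutFn_mem_FP hpk (comp_mem_FP Kannan.zerosFn_mem_FP (comp_mem_FP appF_mem_FP (fanoutFn_mem_FP hpad hpad))))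
  exact fanoutFn_mem_FP (fanoutFn_mem_FP hn hpkT) hrA

/-- `ansD ∈ FP`. [folklore] -/
theorem ansD_mem_FP (hK : P.S.keyGen.IsPolyTime unaryEncodeNat pairCode) (hSg : P.S.sign.IsPolyTime pairCode (id : List Bool → List Bool))
    (Pc : Polynomial ℕ) : ansD P 𝒜 Pc ∈ FP := by
  have hn : wnF ∈ FP := comp_mem_FP onesFn_mem_FP (comp_mem_FP fstF_mem_FP fstF_mem_FP)
  have hr : wrF ∈ FP := comp_mem_FP sndF_mem_FP fstF_mem_FP
  have htab : wtabF ∈ FP := comp_mem_FP sndF_mem_FP sndF_mem_FP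
  have hρ : wρF P 𝒜 ∈ FP := comp_mem_FP dropFn_mem_FP (fanoutFn_mem_FP (comp_mem_FP (polyFn_mem_FP _) hn) hr)
  have hs : asF ∈ FP := fanoutFn_mem_FP (comp_mem_FP hn fstF_mem_FP)
    (fanoutFn_mem_FP (comp_mem_FP onesFn_mem_FP (comp_mem_FP fstF_mem_FP sndF_mem_FP)) (comp_mem_FP htab fstF_mem_FP))
  have hσ : aσF P 𝒜 ∈ FP := comp_mem_FP takeFn_mem_FP (fanoutFn_mem_FP (comp_mem_FP hn fstF_mem_FP) (comp_mem_FP dropFn_mem_FP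
    (fanoutFn_mem_FP (comp_mem_FP umulFn_mem_FP (fanoutFn_mem_FP (comp_mem_FP onesFn_mem_FP (comp_mem_FP fstF_mem_FP sndF_mem_FP))
      (comp_mem_FP hn fstF_mem_FP))) (comp_mem_FP hρ fstF_mem_FP))))
  exact fanoutFn_mem_FP (comp_mem_FP sndF_mem_FP sndF_mem_FP) (comp_mem_FP
    (chainFn_mem_FP _ _ Pc (pkF₀_mem_FP P _ blkTF_mem_FP hK) (sgF₀_mem_FP P _ blkTF_mem_FP hK hSg))
    (fanoutFn_mem_FP (fanoutFn_mem_FP hs (comp_mem_FP sndF_mem_FP sndF_mem_FP)) hσ))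

/-- `hOut ∈ FP`. [folklore] -/
theorem hOut_mem_FP : hOut ∈ FP := fanoutFn_mem_FP (sndPow_mem_FP 1) (nthF_mem_FP 1)

/-- `hOut` on an output record. [folklore] -/
@[simp] theorem hOut_apply (x lb w : List Bool) : hOut (boolPair x (boolPair lb w)) = boolPair w lb := by
  simp [hOut, nthF, sndPow]

/-- The emulated forger is polynomial-time for a PPT forger. [folklore] -/
theorem isPolyTime_EM (h𝒜 : 𝒜.IsPPT ((encodingList Bool).pairBool (encodingList Bool))) : (EM 𝒜).IsPolyTime (encodingList Bool) :=
  isPolyTime_simMFst h𝒜 (fun _ => rfl) _ _ sndF_mem_FP (fun a => by have := length_fstF_sndF_le a; omega) hOut_mem_FP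

/-- `resD ∈ FP`. [folklore] -/
theorem resD_mem_FP (h𝒜 : 𝒜.IsPPT ((encodingList Bool).pairBool (encodingList Bool))) (hK : P.S.keyGen.IsPolyTime unaryEncodeNat pairCode)
    (hSg : P.S.sign.IsPolyTime pairCode (id : List Bool → List Bool)) (Pc c R : Polynomial ℕ) : resD P 𝒜 Pc c R ∈ FP :=
  simFn_mem_FP (isPolyTime_EM 𝒜 h𝒜) (preD_mem_FP P 𝒜 hK) (ansD_mem_FP P 𝒜 hK hSg Pc) c R

end Emulation

/-! ### The forgery test and the distinguisher -/

section Test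

/-! The test reads the emulation input `w` and the result `res = ⟨w_out, ⟨1^{#records}, encList records⟩⟩`, i.e. the
record `z = ⟨w, res⟩`. -/

/-- The forger's output `w_out`. [folklore] -/
noncomputable def zoutF : List Bool → List Bool := fstF ∘ sndF
/-- The answer records (coded list). [folklore] -/
noncomputable def zrecF : List Bool → List Bool := sndF ∘ sndF ∘ sndF
/-- `[w_out is a pair code]` (a time-out is not). [folklore] -/
noncomputable def zpairF : List Bool → List Bool := eqPairFn ∘ fanoutFn zoutF (fanoutFn (fstF ∘ zoutF) (sndF ∘ zoutF))
/-- `[V'(pk', α, sig)]` on the claimed forgery `w_out = ⟨α, sig⟩`. [folklore] -/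
noncomputable def zverF : List Bool → List Bool := verFnT P ∘ fanoutFn (wpkTF P ∘ fstF) (fanoutFn (fstF ∘ zoutF) (sndF ∘ zoutF))
/-- `[α was queried]`: some record echoes `α`. [folklore] -/
noncomputable def zaskedF : List Bool → List Bool := anyFn (eqPairFn ∘ fanoutFn fstF (fstF ∘ sndF)) ∘ fanoutFn (fstF ∘ zoutF) zrecF

/-- **The forgery test** on `⟨w, res⟩`: a genuine output pair, accepted by `V'`, on a document never queried. [Goldreich
2004, Def. 6.1.2] [folklore] -/
noncomputable def testF : List Bool → List Bool := andFn (zpairF) (andFn (zverF P) (notFn (zaskedF)))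

/-- **The output map of `D`**: run the emulation and test. [Goldreich 2004, proof of Prop. 6.4.17] [folklore] -/
noncomputable def GD (Pc c R : Polynomial ℕ) : List Bool → List Bool := testF P ∘ fanoutFn id (resD P 𝒜 Pc c R)

variable {P}

/-- `zpairF` detects pair codes. [folklore] -/
theorem zpairF_apply (w wout lb : List Bool) : zpairF (boolPair w (boolPair wout lb)) = [decide (wout = boolPair (fstF wout) (sndF wout))] := by
  simp [zpairF, zoutF, eqPairFn_boolPair]

/-- `zverF` runs the tree verifier on the claimed forgery. [folklore] -/
theorem zverF_apply (n : ℕ) (r : List Bool) (blocks : List (List Bool)) (wout lb : List Bool) :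
    zverF P (boolPair (boolPair (boolPair (unaryEncodeNat n) r) ((encodingList Bool).listBool.encode blocks)) (boolPair wout lb)) =
      [verifyT P (pkT P n (pkOf P n (blocks.getD 0 []))) (fstF wout) (sndF wout)] := by
  simp only [zverF, zoutF, Function.comp_apply, fanoutFn_apply, fstF_boolPair, sndF_boolPair, wpkTF_apply, verFnT_apply]

/-- `zaskedF` tests whether the document was echoed by some answer record. [folklore] -/
theorem zaskedF_apply (w wout : List Bool) (records : List (List Bool)) :
    zaskedF (boolPair w (boolPair wout ((encodingList Bool).listBool.encode records))) = [decide (fstF wout ∈ records.map fstF)] := by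
  have h1 : OneBit (eqPairFn ∘ fanoutFn fstF (fstF ∘ sndF)) := fun z => by
    rw [Function.comp_apply, fanoutFn_apply, eqPairFn_boolPair]; exact ⟨_, rfl⟩
  rw [zaskedF, Function.comp_apply, fanoutFn_apply, PrefixPostPoly.listBool_encode_eq]
  simp only [zoutF, zrecF, Function.comp_apply, fstF_boolPair, sndF_boolPair]
  rw [anyFn_boolPair h1, decNil_encList]
  simp only [Function.comp_apply, fanoutFn_apply, fstF_boolPair, sndF_boolPair, eqPairFn_boolPair, List.cons.injEq, and_true,
    decide_eq_true_eq, List.mem_map, decide_eq_decide]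
  constructor
  · rintro ⟨a, ha, h⟩; exact ⟨a, ha, h.symm⟩
  · rintro ⟨a, ha, h⟩; exact ⟨a, ha, h.symm⟩

/-- **The forgery test on a genuine emulation record.** [folklore] -/
theorem testF_apply (n : ℕ) (r : List Bool) (blocks : List (List Bool)) (wout : List Bool) (records : List (List Bool)) :
    testF P (boolPair (boolPair (boolPair (unaryEncodeNat n) r) ((encodingList Bool).listBool.encode blocks))
      (boolPair wout ((encodingList Bool).listBool.encode records))) =
      [decide (wout = boolPair (fstF wout) (sndF wout)) &&
        (verifyT P (pkT P n (pkOf P n (blocks.getD 0 []))) (fstF wout) (sndF wout) && !decide (fstF wout ∈ records.map fstF))] := by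
  rw [testF, andFn_apply (zpairF_apply _ _ _) (andFn_apply (zverF_apply n r blocks wout _) (notFn_apply (zaskedF_apply _ wout records)))]

variable (P)

/-- `testF ∈ FP`. [folklore] -/
theorem testF_mem_FP (hK : P.S.keyGen.IsPolyTime unaryEncodeNat pairCode)
    (hV : PolyTimeComputable SignatureScheme.verifyCode encodeBool (fun p : List Bool × List Bool × List Bool => P.S.verify p.1 p.2.1 p.2.2)) :
    testF P ∈ FP := by
  have hout : zoutF ∈ FP := comp_mem_FP fstF_mem_FP sndF_mem_FP
  have hrec : zrecF ∈ FP := comp_mem_FP sndF_mem_FP (comp_mem_FP sndF_mem_FP sndF_mem_FP)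
  have hpair : zpairF ∈ FP := comp_mem_FP eqPairFn_mem_FP (fanoutFn_mem_FP hout (fanoutFn_mem_FP (comp_mem_FP fstF_mem_FP hout) (comp_mem_FP sndF_mem_FP hout)))
  have hn : wnF ∈ FP := comp_mem_FP onesFn_mem_FP (comp_mem_FP fstF_mem_FP fstF_mem_FP)
  have htab : wtabF ∈ FP := comp_mem_FP sndF_mem_FP sndF_mem_FP
  have hs0 : ws0F ∈ FP := fanoutFn_mem_FP hn (fanoutFn_mem_FP (const_mem_FP _) htab)
  have hpk : wpkF P ∈ FP := comp_mem_FP (pkF₀_mem_FP P _ blkTF_mem_FP hK) (fanoutFn_mem_FP hs0 (const_mem_FP _))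
  have hpad : wpadF P ∈ FP := comp_mem_FP dropFn_mem_FP (fanoutFn_mem_FP hpk (comp_mem_FP (polyFn_mem_FP _) hn))
  have hpkT : wpkTF P ∈ FP := fanoutFn_mem_FP hn (fanoutFn_mem_FP hpk (comp_mem_FP Kannan.zerosFn_mem_FP (comp_mem_FP appF_mem_FP (fanoutFn_mem_FP hpad hpad))))
  have hver : zverF P ∈ FP := comp_mem_FP (verFnT_mem_FP P hV) (fanoutFn_mem_FP (comp_mem_FP hpkT fstF_mem_FP)
    (fanoutFn_mem_FP (comp_mem_FP fstF_mem_FP hout) (comp_mem_FP sndF_mem_FP hout)))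
  have h1 : OneBit (eqPairFn ∘ fanoutFn fstF (fstF ∘ sndF)) := fun z => by
    rw [Function.comp_apply, fanoutFn_apply, eqPairFn_boolPair]; exact ⟨_, rfl⟩
  have hasked : zaskedF ∈ FP := comp_mem_FP (anyFn_mem_FP (comp_mem_FP eqPairFn_mem_FP (fanoutFn_mem_FP fstF_mem_FP (comp_mem_FP fstF_mem_FP sndF_mem_FP))) h1)
    (fanoutFn_mem_FP (comp_mem_FP fstF_mem_FP hout) hrec)
  exact andFn_mem_FP hpair (andFn_mem_FP hver (notFn_mem_FP hasked))

/-- `GD ∈ FP`. [folklore] -/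
theorem GD_mem_FP (h𝒜 : 𝒜.IsPPT ((encodingList Bool).pairBool (encodingList Bool))) (hS : P.S.IsEfficient) (Pc c R : Polynomial ℕ) :
    GD P 𝒜 Pc c R ∈ FP :=
  comp_mem_FP (testF_mem_FP P hS.1 hS.2.2) (fanoutFn_mem_FP id_mem_FP (resD_mem_FP P 𝒜 h𝒜 hS.1 hS.2.1 Pc c R))

/-- The distinguisher's algorithm: fetch (the clock of the fetch phase runs on the length of the whole input `⟨1ⁿ, r⟩`, so
`qD(|⟨1ⁿ, r⟩|) ≥ qD(n)` blocks are fetched — the surplus is never read), emulate, test (the test bit read through `headD`).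
[Goldreich 2004, proof of Prop. 6.4.17] [folklore] -/
noncomputable def DAlg (Pc c R : Polynomial ℕ) : OracleAlg Bool := (ttFnAlgL (QD P 𝒜) (qD P 𝒜) (GD P 𝒜 Pc c R)).postOut (sndPow 1)

/-- The number of blocks fetched on `⟨1ⁿ, r⟩`. [folklore] -/
noncomputable def nFetch (n : ℕ) (r : List Bool) : ℕ := (qD P 𝒜).eval (boolPair (unaryEncodeNat n) r).length

/-- Enough blocks are fetched: `1 + 2n·TA(n) ≤ nFetch n r`. [folklore] -/
theorem qD_le_nFetch (n : ℕ) (r : List Bool) : 1 + 2 * n * TA P 𝒜 n ≤ nFetch P 𝒜 n r := by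
  rw [nFetch, ← qD_eval]
  exact TM2Iter.eval_mono _ (by rw [length_boolPair, Complexity.unaryEncodeNat_eq_replicate, List.length_replicate]; omega)

/-- The round budget of `D` on `1ⁿ`: beyond the fetch phase on `⟨1ⁿ, r⟩`, `|r| = cD(n)`. [folklore] -/
noncomputable def fuelD : Polynomial ℕ := (qD P 𝒜).comp (2 * X + 2 + cDPoly P 𝒜) + 1

/-- `fuelD(n) = qD(2n + 2 + cD(n)) + 1`. [folklore] -/
theorem fuelD_eval (n : ℕ) {r : List Bool} (hr : r.length = (cDPoly P 𝒜).eval n) : (fuelD P 𝒜).eval n = nFetch P 𝒜 n r + 1 := by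
  simp only [fuelD, nFetch, eval_add, eval_comp, eval_mul, eval_ofNat, eval_X, eval_one, length_boolPair, Complexity.unaryEncodeNat_eq_replicate,
    List.length_replicate, hr]

/-- **The PRF distinguisher** `D`: coins `cA(n) + TA(n)·n`, rounds `fuelD(n)`. [Goldreich 2004, proof of Prop. 6.4.17]
[cite: Goldreich2004, Prop. 6.4.17] -/
noncomputable def distinguisher (Pc c R : Polynomial ℕ) : OracleAdversary Bool := ⟨DAlg P 𝒜 Pc c R, cDPoly P 𝒜, fuelD P 𝒜⟩

/-- **`D` is PPT** (for a PPT forger and an efficient one-time scheme). [Goldreich 2004, proof of Prop. 6.4.17] [folklore] -/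
theorem isPPT_distinguisher (h𝒜 : 𝒜.IsPPT ((encodingList Bool).pairBool (encodingList Bool))) (hS : P.S.IsEfficient) (Pc c R : Polynomial ℕ) :
    (distinguisher P 𝒜 Pc c R).IsPPT encodingBoolBool :=
  isPolyTime_postOut (isPolyTime_ttFnAlgL (QD_mem_FP P 𝒜) (GD_mem_FP P 𝒜 h𝒜 hS Pc c R)) (sndPow_mem_FP 1)

/-- The blocks fetched on `⟨1ⁿ, r⟩` against `O`: those of the labels `labAt n ρ j`, `j < nFetch n r`. [folklore] -/
noncomputable def fetched (O : Oracle) (n : ℕ) (r : List Bool) : List (List Bool) :=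
  (List.range (nFetch P 𝒜 n r)).map fun j => O (code n (labAt n (ρD P 𝒜 n r) j))

/-- **The run of `D`** against any oracle `O`, within any budget beyond the fetch phase: the head of the test
`GD ⟨⟨1ⁿ, r⟩, listBool (fetched blocks)⟩`. [folklore] -/
theorem run_DAlg (Pc c R : Polynomial ℕ) (O : Oracle) (n : ℕ) (r : List Bool) {m : ℕ} (hm : nFetch P 𝒜 n r < m) :
    (DAlg P 𝒜 Pc c R).run O m (boolPair (unaryEncodeNat n) r) =
      some ((GD P 𝒜 Pc c R (boolPair (boolPair (unaryEncodeNat n) r) ((encodingList Bool).listBool.encode (fetched P 𝒜 O n r)))).headD false) := by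
  have hrun : (ttFnAlgL (QD P 𝒜) (qD P 𝒜) (GD P 𝒜 Pc c R)).runAux O (boolPair (unaryEncodeNat n) r) m [] =
      some (ttFnL (QD P 𝒜) (qD P 𝒜) (GD P 𝒜 Pc c R) O (boolPair (unaryEncodeNat n) r)) :=
    run_ttFnAlgL O _ hm
  have h := runAux_postOut _ (sndPow 1) O (boolPair (unaryEncodeNat n) r) m [] _ hrun
  have hfetch : (ttQueries (QD P 𝒜) (boolPair (unaryEncodeNat n) r) ((qD P 𝒜).eval (boolPair (unaryEncodeNat n) r).length)).map O =
      fetched P 𝒜 O n r := by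
    rw [fetched, nFetch, ttQueries, List.map_map]
    refine List.map_congr_left fun j _ => ?_
    rw [Function.comp_apply, QD_apply]
  rw [DAlg, run, h.1, List.nil_append, ttFnL_apply, hfetch]
  simp only [sndPow_succ_boolPair, sndPow_zero_boolPair]

end Test

end TreeSig

end Literature.Computability.Cryptography
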